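import Summits.HubbardSuperconductivity.HubbardSuperconductivity.Theorems.NodalWardXYPerturbedXYOrderRelTwistAlgebra
import Summits.HubbardSuperconductivity.HubbardSuperconductivity.Theorems.NodalWardXYPerturbedXYOrderRelWardBound

/-!
# `PerturbedXYOrder` (stmt-HubbardSuperconductivity-10739) — line `schwarz-inheritance`, stub `stub_relTwistedJensenBound`

Tools (III) for the negative lemma N10′ of lead c19 (`Theorems/PerturbedXYOrder/Negative/InvariantRelBoundedPinching.lean`): the TWISTED
side for the energy-weighted source `R`:

* `gr_rel_twist_k` — one wave number: `gp_twisted_jensen_symm` (p156616) with the source as a function of the spins, then the pointwise bound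
  `gr_twist_R_symm_le` (energy `E ≤ 6L³`):
  `log ⟨e^{−σR/L³}⟩_J ≥ −(σ/L³)[72tL⁶ + ⟨V_k⟩_J/t + 2L³ cost_k + 2L³ Σ_b|sin∇_b g_k|] − J cost_k`;
* `gr_rel_lower_neg` = registered stub `stub_relTwistedJensenBound` — averaged over `k = 1,…,n²` at `t = 1/(6n)`, with the character-sum
  bound `Σ_k ⟨V_k⟩ ≤ L⁶` (p156624), `cost_k ≤ 2π²n⁴L` and `Σ_b|sin∇_b g_k| ≤ 2πn²L²`:
  `log ⟨e^{−σR/L³}⟩_J ≥ −18σL³/n − 4π²σn⁴L − 4πσn²L² − 2π²n⁴JL` (`J, σ ≥ 0`, `1 ≤ n`, `n² < L`) — the AM–GM weight `t` trades the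
  uncontrolled weighted pairing `Σ_b c_b Ψ_k` against the orthogonality of the unweighted twisted magnetisations.
-/

noncomputable section

namespace Summit.HubbardSuperconductivity.HubbardSuperconductivity.Theorems.PerturbedXYOrder

open MeasureTheory Literature.Probability.LatticeModels Metric Set
open Summit.HubbardSuperconductivity.HubbardSuperconductivity.Theses.NodalWardXY

variable {L : ℕ}

/-- **Twisted side, one wave number.** For `J ≥ 0`, `σ ≥ 0`, the axial twist `g_k` and `t > 0`:
`log ⟨e^{−σR/L³}⟩_J ≥ −(σ/L³)[72 t L⁶ + ⟨V_k⟩_J/t + 2L³ cost_k + 2L³ Σ_b|sin ∇_b g_k|] − J cost_k`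
(`gp_twisted_jensen_symm` with the source as a function of the spins, and the pointwise bound `gr_twist_R_symm_le`). -/
theorem gr_rel_twist_k [NeZero L] {J : ℝ} (hJ : 0 ≤ J) {σ : ℝ} (hσ : 0 ≤ σ) (k : ℕ) {t : ℝ} (ht : 0 < t) :
    -(σ / (L : ℝ) ^ 3) * (72 * t * ((L : ℝ) ^ 3) ^ 2 +
        (∫ θ in cube L, (∑ x : TorusSite 3 L, ∑ y : TorusSite 3 L, Real.cos (θ x - θ y) *
          Real.cos (2 * Real.pi * k * ((x 0).val : ℝ) / L - 2 * Real.pi * k * ((y 0).val : ℝ) / L)) * (wJ J θ).re) /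
          (∫ θ in cube L, (wJ J θ).re) / t +
        2 * (L : ℝ) ^ 3 * ∑ b : Bond L, (1 - Real.cos (2 * Real.pi * k * (((b.1 + Pi.single b.2 1 : TorusSite 3 L) 0).val : ℝ) / L -
          2 * Real.pi * k * ((b.1 0).val : ℝ) / L)) +
        2 * (L : ℝ) ^ 3 * ∑ b : Bond L, |Real.sin (2 * Real.pi * k * (((b.1 + Pi.single b.2 1 : TorusSite 3 L) 0).val : ℝ) / L -
          2 * Real.pi * k * ((b.1 0).val : ℝ) / L)|) -
      J * ∑ b : Bond L, (1 - Real.cos (2 * Real.pi * k * (((b.1 + Pi.single b.2 1 : TorusSite 3 L) 0).val : ℝ) / L -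
          2 * Real.pi * k * ((b.1 0).val : ℝ) / L)) ≤
      Real.log ((∫ θ in cube L, Real.exp (-σ * ((∑ y : TorusSite 3 L, ∑ b : Bond L,
        (Real.cos (θ b.1 - θ y) + Real.cos (θ (b.1 + Pi.single b.2 1) - θ y)) *
          (1 - Real.cos (θ (b.1 + Pi.single b.2 1) - θ b.1))) / (L : ℝ) ^ 3)) * (wJ J θ).re) /
        ∫ θ in cube L, (wJ J θ).re) := by
  have hL0 : (0 : ℝ) < L := by have := NeZero.pos L; exact_mod_cast this
  have hwc : Continuous fun θ : TorusSite 3 L → ℝ => (wJ J θ).re := gp_continuous_wJ_re J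
  have hZ : 0 < ∫ θ in cube L, (wJ J θ).re := gp_integral_wJ_re_pos J
  set Z : ℝ := ∫ θ in cube L, (wJ J θ).re with hZdef
  set g : TorusSite 3 L → ℝ := fun x => 2 * Real.pi * k * ((x 0).val : ℝ) / L with hgdef
  set F : (TorusSite 3 L → Circle) → ℝ := fun z => -σ / (L : ℝ) ^ 3 * ∑ y : TorusSite 3 L, ∑ b : Bond L,
    (reChar (diffChar y b.1) z + reChar (diffChar y (b.1 + Pi.single b.2 1)) z) *
      (1 - reChar (diffChar b.1 (b.1 + Pi.single b.2 1)) z) with hFdef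
  have hF : Continuous F := by
    refine continuous_const.mul (continuous_finsetSum _ fun y _ => continuous_finsetSum _ fun b _ => ?_)
    exact ((continuous_reChar _).add (continuous_reChar _)).mul (continuous_const.sub (continuous_reChar _))
  have h := gp_twisted_jensen_symm (L := L) hJ g hF
  simp only [hFdef, reChar_diffChar_exp] at h
  -- the pointwise bound on the symmetrised twisted source
  set B : (TorusSite 3 L → ℝ) → ℝ := fun θ => 72 * t * ((L : ℝ) ^ 3) ^ 2 +
    (∑ x : TorusSite 3 L, ∑ y : TorusSite 3 L, Real.cos (θ x - θ y) * Real.cos (g x - g y)) / t +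
    (L : ℝ) ^ 3 * (2 * ∑ b : Bond L, (1 - Real.cos (g (b.1 + Pi.single b.2 1) - g b.1))) +
    (L : ℝ) ^ 3 * (2 * ∑ b : Bond L, |Real.sin (g (b.1 + Pi.single b.2 1) - g b.1)|) with hBdef
  have hBc : Continuous B := by simp only [hBdef]; fun_prop
  have hpt : ∀ θ : TorusSite 3 L → ℝ, (-σ / (L : ℝ) ^ 3 * B θ) * (wJ J θ).re ≤
      ((-σ / (L : ℝ) ^ 3 * ∑ y : TorusSite 3 L, ∑ b : Bond L,
          (Real.cos ((θ b.1 + g b.1) - (θ y + g y)) + Real.cos ((θ (b.1 + Pi.single b.2 1) + g (b.1 + Pi.single b.2 1)) - (θ y + g y))) *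
            (1 - Real.cos ((θ (b.1 + Pi.single b.2 1) + g (b.1 + Pi.single b.2 1)) - (θ b.1 + g b.1)))) +
        (-σ / (L : ℝ) ^ 3 * ∑ y : TorusSite 3 L, ∑ b : Bond L,
          (Real.cos ((θ b.1 - g b.1) - (θ y - g y)) + Real.cos ((θ (b.1 + Pi.single b.2 1) - g (b.1 + Pi.single b.2 1)) - (θ y - g y))) *
            (1 - Real.cos ((θ (b.1 + Pi.single b.2 1) - g (b.1 + Pi.single b.2 1)) - (θ b.1 - g b.1))))) / 2 *
        (wJ J θ).re := by
    intro θ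
    have hb := gr_twist_R_symm_le θ g ht
    have hE := fv_energy_le θ
    have hE0 := fv_energy_nonneg θ
    have hwθ : 0 ≤ (wJ J θ).re := (gp_wJ_re_pos J θ).le
    have hcoef : -σ / (L : ℝ) ^ 3 ≤ 0 := div_nonpos_of_nonpos_of_nonneg (by linarith) (by positivity)
    have hE2 : 2 * t * (∑ b : Bond L, (1 - Real.cos (θ (b.1 + Pi.single b.2 1) - θ b.1))) ^ 2 ≤ 72 * t * ((L : ℝ) ^ 3) ^ 2 := by
      have : (∑ b : Bond L, (1 - Real.cos (θ (b.1 + Pi.single b.2 1) - θ b.1))) ^ 2 ≤ (6 * (L : ℝ) ^ 3) ^ 2 :=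
        pow_le_pow_left₀ hE0 hE 2
      nlinarith
    have hB' : ((∑ y : TorusSite 3 L, ∑ b : Bond L,
          (Real.cos ((θ b.1 + g b.1) - (θ y + g y)) + Real.cos ((θ (b.1 + Pi.single b.2 1) + g (b.1 + Pi.single b.2 1)) - (θ y + g y))) *
            (1 - Real.cos ((θ (b.1 + Pi.single b.2 1) + g (b.1 + Pi.single b.2 1)) - (θ b.1 + g b.1)))) +
        ∑ y : TorusSite 3 L, ∑ b : Bond L,
          (Real.cos ((θ b.1 - g b.1) - (θ y - g y)) + Real.cos ((θ (b.1 + Pi.single b.2 1) - g (b.1 + Pi.single b.2 1)) - (θ y - g y))) *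
            (1 - Real.cos ((θ (b.1 + Pi.single b.2 1) - g (b.1 + Pi.single b.2 1)) - (θ b.1 - g b.1)))) / 2 ≤ B θ := by
      simp only [hBdef]
      linarith
    have := mul_le_mul_of_nonpos_left hB' hcoef
    have := mul_le_mul_of_nonneg_right this hwθ
    refine le_trans this (le_of_eq ?_)
    ring
  have hIl : Integrable (fun θ => (-σ / (L : ℝ) ^ 3 * B θ) * (wJ J θ).re) (volume.restrict (cube L)) :=
    gp_integrable ((continuous_const.mul hBc).mul hwc)
  have hIr : Integrable (fun θ : TorusSite 3 L → ℝ => ((-σ / (L : ℝ) ^ 3 * ∑ y : TorusSite 3 L, ∑ b : Bond L,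
          (Real.cos ((θ b.1 + g b.1) - (θ y + g y)) + Real.cos ((θ (b.1 + Pi.single b.2 1) + g (b.1 + Pi.single b.2 1)) - (θ y + g y))) *
            (1 - Real.cos ((θ (b.1 + Pi.single b.2 1) + g (b.1 + Pi.single b.2 1)) - (θ b.1 + g b.1)))) +
        (-σ / (L : ℝ) ^ 3 * ∑ y : TorusSite 3 L, ∑ b : Bond L,
          (Real.cos ((θ b.1 - g b.1) - (θ y - g y)) + Real.cos ((θ (b.1 + Pi.single b.2 1) - g (b.1 + Pi.single b.2 1)) - (θ y - g y))) *
            (1 - Real.cos ((θ (b.1 + Pi.single b.2 1) - g (b.1 + Pi.single b.2 1)) - (θ b.1 - g b.1))))) / 2 *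
        (wJ J θ).re) (volume.restrict (cube L)) := by
    refine gp_integrable (Continuous.mul ?_ hwc)
    fun_prop
  have hmono := integral_mono hIl hIr hpt
  -- evaluate the left integral
  have hIB : ∫ θ in cube L, (-σ / (L : ℝ) ^ 3 * B θ) * (wJ J θ).re =
      -σ / (L : ℝ) ^ 3 * ((72 * t * ((L : ℝ) ^ 3) ^ 2 +
        (L : ℝ) ^ 3 * (2 * ∑ b : Bond L, (1 - Real.cos (g (b.1 + Pi.single b.2 1) - g b.1))) +
        (L : ℝ) ^ 3 * (2 * ∑ b : Bond L, |Real.sin (g (b.1 + Pi.single b.2 1) - g b.1)|)) * Z +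
        (∫ θ in cube L, (∑ x : TorusSite 3 L, ∑ y : TorusSite 3 L, Real.cos (θ x - θ y) * Real.cos (g x - g y)) *
          (wJ J θ).re) / t) := by
    have hV : Continuous fun θ : TorusSite 3 L → ℝ =>
        ∑ x : TorusSite 3 L, ∑ y : TorusSite 3 L, Real.cos (θ x - θ y) * Real.cos (g x - g y) := by fun_prop
    have hI1 : Integrable (fun θ : TorusSite 3 L → ℝ => (72 * t * ((L : ℝ) ^ 3) ^ 2 +
        (L : ℝ) ^ 3 * (2 * ∑ b : Bond L, (1 - Real.cos (g (b.1 + Pi.single b.2 1) - g b.1))) +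
        (L : ℝ) ^ 3 * (2 * ∑ b : Bond L, |Real.sin (g (b.1 + Pi.single b.2 1) - g b.1)|)) * (wJ J θ).re)
        (volume.restrict (cube L)) := (gp_integrable hwc).const_mul _
    have hI2 : Integrable (fun θ : TorusSite 3 L → ℝ => (1 / t) *
        ((∑ x : TorusSite 3 L, ∑ y : TorusSite 3 L, Real.cos (θ x - θ y) * Real.cos (g x - g y)) * (wJ J θ).re))
        (volume.restrict (cube L)) := (gp_integrable (hV.mul hwc)).const_mul _
    have hsplit : (fun θ => (-σ / (L : ℝ) ^ 3 * B θ) * (wJ J θ).re) = fun θ => -σ / (L : ℝ) ^ 3 *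
        ((72 * t * ((L : ℝ) ^ 3) ^ 2 +
          (L : ℝ) ^ 3 * (2 * ∑ b : Bond L, (1 - Real.cos (g (b.1 + Pi.single b.2 1) - g b.1))) +
          (L : ℝ) ^ 3 * (2 * ∑ b : Bond L, |Real.sin (g (b.1 + Pi.single b.2 1) - g b.1)|)) * (wJ J θ).re +
        (1 / t) * ((∑ x : TorusSite 3 L, ∑ y : TorusSite 3 L, Real.cos (θ x - θ y) * Real.cos (g x - g y)) * (wJ J θ).re)) := by
      funext θ; simp only [hBdef]; field_simp; ring
    rw [hsplit, integral_const_mul, integral_add hI1 hI2, integral_const_mul, integral_const_mul]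
    rw [hZdef]
    field_simp
  rw [hIB] at hmono
  -- compare with `h`
  have hdiv := div_le_div_of_nonneg_right hmono hZ.le
  have e : -σ / (L : ℝ) ^ 3 * ((72 * t * ((L : ℝ) ^ 3) ^ 2 +
        (L : ℝ) ^ 3 * (2 * ∑ b : Bond L, (1 - Real.cos (g (b.1 + Pi.single b.2 1) - g b.1))) +
        (L : ℝ) ^ 3 * (2 * ∑ b : Bond L, |Real.sin (g (b.1 + Pi.single b.2 1) - g b.1)|)) * Z +
        (∫ θ in cube L, (∑ x : TorusSite 3 L, ∑ y : TorusSite 3 L, Real.cos (θ x - θ y) * Real.cos (g x - g y)) *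
          (wJ J θ).re) / t) / Z =
      -σ / (L : ℝ) ^ 3 * ((72 * t * ((L : ℝ) ^ 3) ^ 2 +
        (L : ℝ) ^ 3 * (2 * ∑ b : Bond L, (1 - Real.cos (g (b.1 + Pi.single b.2 1) - g b.1))) +
        (L : ℝ) ^ 3 * (2 * ∑ b : Bond L, |Real.sin (g (b.1 + Pi.single b.2 1) - g b.1)|)) +
        (∫ θ in cube L, (∑ x : TorusSite 3 L, ∑ y : TorusSite 3 L, Real.cos (θ x - θ y) * Real.cos (g x - g y)) *
          (wJ J θ).re) / Z / t) := by
    field_simp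
  rw [e] at hdiv
  have hconv : ∫ θ in cube L, Real.exp (-σ / (L : ℝ) ^ 3 * ∑ y : TorusSite 3 L, ∑ b : Bond L,
        (Real.cos (θ b.1 - θ y) + Real.cos (θ (b.1 + Pi.single b.2 1) - θ y)) *
          (1 - Real.cos (θ (b.1 + Pi.single b.2 1) - θ b.1))) * (wJ J θ).re =
      ∫ θ in cube L, Real.exp (-σ * ((∑ y : TorusSite 3 L, ∑ b : Bond L,
        (Real.cos (θ b.1 - θ y) + Real.cos (θ (b.1 + Pi.single b.2 1) - θ y)) *
          (1 - Real.cos (θ (b.1 + Pi.single b.2 1) - θ b.1))) / (L : ℝ) ^ 3)) * (wJ J θ).re := by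
    refine integral_congr_ae (ae_of_all _ fun θ => ?_)
    dsimp only
    congr 2
    ring
  rw [hconv] at h
  rw [← hZdef] at h
  simp only [hgdef] at h hdiv ⊢
  have e2 : -(σ / (L : ℝ) ^ 3) * (72 * t * ((L : ℝ) ^ 3) ^ 2 +
        (∫ θ in cube L, (∑ x : TorusSite 3 L, ∑ y : TorusSite 3 L, Real.cos (θ x - θ y) *
          Real.cos (2 * Real.pi * k * ((x 0).val : ℝ) / L - 2 * Real.pi * k * ((y 0).val : ℝ) / L)) * (wJ J θ).re) / Z / t +
        2 * (L : ℝ) ^ 3 * ∑ b : Bond L, (1 - Real.cos (2 * Real.pi * k * (((b.1 + Pi.single b.2 1 : TorusSite 3 L) 0).val : ℝ) / L -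
          2 * Real.pi * k * ((b.1 0).val : ℝ) / L)) +
        2 * (L : ℝ) ^ 3 * ∑ b : Bond L, |Real.sin (2 * Real.pi * k * (((b.1 + Pi.single b.2 1 : TorusSite 3 L) 0).val : ℝ) / L -
          2 * Real.pi * k * ((b.1 0).val : ℝ) / L)|) =
      -σ / (L : ℝ) ^ 3 * ((72 * t * ((L : ℝ) ^ 3) ^ 2 +
        (L : ℝ) ^ 3 * (2 * ∑ b : Bond L, (1 - Real.cos (2 * Real.pi * k * (((b.1 + Pi.single b.2 1 : TorusSite 3 L) 0).val : ℝ) / L -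
          2 * Real.pi * k * ((b.1 0).val : ℝ) / L))) +
        (L : ℝ) ^ 3 * (2 * ∑ b : Bond L, |Real.sin (2 * Real.pi * k * (((b.1 + Pi.single b.2 1 : TorusSite 3 L) 0).val : ℝ) / L -
          2 * Real.pi * k * ((b.1 0).val : ℝ) / L)|)) +
        (∫ θ in cube L, (∑ x : TorusSite 3 L, ∑ y : TorusSite 3 L, Real.cos (θ x - θ y) *
          Real.cos (2 * Real.pi * k * ((x 0).val : ℝ) / L - 2 * Real.pi * k * ((y 0).val : ℝ) / L)) * (wJ J θ).re) / Z / t) := by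
    ring
  rw [e2]
  linarith [h, hdiv]

/-- **Twisted side for the energy-weighted source.** For `J ≥ 0`, `σ ≥ 0`, `n ≥ 1` with `n² < L`:
`log ⟨e^{−σR/L³}⟩_J ≥ −18σL³/n − 4π²σn⁴L − 4πσn²L² − 2π²n⁴JL`
(average of `gr_rel_twist_k` over `k = 1,…,n²` at `t = 1/(6n)`; the twisted two-point sums total `≤ L⁶` by `gp_twistCorr_sum_le`, the costs are
`≤ 2π²n⁴L` by `gp_twist_cost_le` and `Σ_b |sin ∇_b g_k| ≤ 2πn²L²` by `gr_sum_abs_sin_twist_le`). -/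
theorem gr_rel_lower_neg [NeZero L] (hL : 2 ≤ L) {J : ℝ} (hJ : 0 ≤ J) {σ : ℝ} (hσ : 0 ≤ σ) {n : ℕ}
    (hn : 1 ≤ n) (hnL : n ^ 2 < L) :
    -(18 * σ * (L : ℝ) ^ 3 / n) - 4 * Real.pi ^ 2 * σ * (n : ℝ) ^ 4 * L - 4 * Real.pi * σ * (n : ℝ) ^ 2 * (L : ℝ) ^ 2 -
        2 * Real.pi ^ 2 * (n : ℝ) ^ 4 * J * L ≤
      Real.log ((∫ θ in cube L, Real.exp (-σ * ((∑ y : TorusSite 3 L, ∑ b : Bond L,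
        (Real.cos (θ b.1 - θ y) + Real.cos (θ (b.1 + Pi.single b.2 1) - θ y)) *
          (1 - Real.cos (θ (b.1 + Pi.single b.2 1) - θ b.1))) / (L : ℝ) ^ 3)) * (wJ J θ).re) /
        ∫ θ in cube L, (wJ J θ).re) := by
  have hL0 : (0 : ℝ) < L := by have := NeZero.pos L; exact_mod_cast this
  have hn0 : (0 : ℝ) < n := by exact_mod_cast hn
  have hwc : Continuous fun θ : TorusSite 3 L → ℝ => (wJ J θ).re := gp_continuous_wJ_re J
  have hZ : 0 < ∫ θ in cube L, (wJ J θ).re := gp_integral_wJ_re_pos J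
  set m : ℕ := n ^ 2 with hmdef
  have hm1 : 1 ≤ m := by rw [hmdef]; exact Nat.one_le_pow _ _ hn
  have hm0 : (0 : ℝ) < m := by exact_mod_cast hm1
  have hmr : (m : ℝ) = (n : ℝ) ^ 2 := by rw [hmdef]; push_cast; ring
  have hmL : m < L := hnL
  set t : ℝ := 1 / (6 * n) with htdef
  have ht : 0 < t := by positivity
  set Z : ℝ := ∫ θ in cube L, (wJ J θ).re with hZdef
  set R : ℝ := Real.log ((∫ θ in cube L, Real.exp (-σ * ((∑ y : TorusSite 3 L, ∑ b : Bond L,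
        (Real.cos (θ b.1 - θ y) + Real.cos (θ (b.1 + Pi.single b.2 1) - θ y)) *
          (1 - Real.cos (θ (b.1 + Pi.single b.2 1) - θ b.1))) / (L : ℝ) ^ 3)) * (wJ J θ).re) / Z) with hR
  set V : ℕ → (TorusSite 3 L → ℝ) → ℝ := fun k θ => ∑ x : TorusSite 3 L, ∑ y : TorusSite 3 L, Real.cos (θ x - θ y) *
    Real.cos (2 * Real.pi * k * ((x 0).val : ℝ) / L - 2 * Real.pi * k * ((y 0).val : ℝ) / L) with hV
  set cost : ℕ → ℝ := fun k => ∑ b : Bond L, (1 - Real.cos (2 * Real.pi * k *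
    (((b.1 + Pi.single b.2 1 : TorusSite 3 L) 0).val : ℝ) / L - 2 * Real.pi * k * ((b.1 0).val : ℝ) / L)) with hcost
  set sinabs : ℕ → ℝ := fun k => ∑ b : Bond L, |Real.sin (2 * Real.pi * k *
    (((b.1 + Pi.single b.2 1 : TorusSite 3 L) 0).val : ℝ) / L - 2 * Real.pi * k * ((b.1 0).val : ℝ) / L)| with hsinabs
  have hVc : ∀ k, Continuous (V k) := by intro k; simp only [hV]; fun_prop
  have hk : ∀ k : ℕ, -(σ / (L : ℝ) ^ 3) * (72 * t * ((L : ℝ) ^ 3) ^ 2 + (∫ θ in cube L, V k θ * (wJ J θ).re) / Z / t +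
      2 * (L : ℝ) ^ 3 * cost k + 2 * (L : ℝ) ^ 3 * sinabs k) - J * cost k ≤ R := by
    intro k
    have h := gr_rel_twist_k (L := L) hJ hσ k ht
    simp only [hV, hcost, hsinabs, hR, hZdef]
    exact h
  -- sum over `k = 1, …, m`
  have hsum : ∑ k ∈ Finset.Icc 1 m, (-(σ / (L : ℝ) ^ 3) * (72 * t * ((L : ℝ) ^ 3) ^ 2 +
      (∫ θ in cube L, V k θ * (wJ J θ).re) / Z / t + 2 * (L : ℝ) ^ 3 * cost k + 2 * (L : ℝ) ^ 3 * sinabs k) - J * cost k) ≤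
      ∑ _k ∈ Finset.Icc 1 m, R := Finset.sum_le_sum fun k _ => hk k
  rw [Finset.sum_const, Nat.card_Icc, Nat.add_sub_cancel, nsmul_eq_mul] at hsum
  -- bounds on the summed pieces
  have hI : ∀ k, Integrable (fun θ => V k θ * (wJ J θ).re) (volume.restrict (cube L)) :=
    fun k => gp_integrable ((hVc k).mul hwc)
  have h1 : ∑ k ∈ Finset.Icc 1 m, (∫ θ in cube L, V k θ * (wJ J θ).re) / Z ≤ ((L : ℝ) ^ 3) ^ 2 := by
    rw [← Finset.sum_div, ← integral_finsetSum _ fun k _ => hI k, div_le_iff₀ hZ]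
    have hpt : ∀ θ : TorusSite 3 L → ℝ, ∑ k ∈ Finset.Icc 1 m, V k θ * (wJ J θ).re ≤ ((L : ℝ) ^ 3) ^ 2 * (wJ J θ).re := by
      intro θ
      rw [← Finset.sum_mul]
      refine mul_le_mul_of_nonneg_right ?_ (gp_wJ_re_pos J θ).le
      have hb := gp_twistCorr_sum_le hmL θ
      simpa only [hV] using hb
    have hIl : Integrable (fun θ => ∑ k ∈ Finset.Icc 1 m, V k θ * (wJ J θ).re) (volume.restrict (cube L)) :=
      integrable_finsetSum _ fun k _ => hI k
    have hIr : Integrable (fun θ => ((L : ℝ) ^ 3) ^ 2 * (wJ J θ).re) (volume.restrict (cube L)) :=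
      (gp_integrable hwc).const_mul _
    have := integral_mono hIl hIr hpt
    rw [integral_const_mul] at this
    exact this
  have h2 : ∀ k ∈ Finset.Icc 1 m, cost k ≤ 2 * Real.pi ^ 2 * (m : ℝ) ^ 2 * L := by
    intro k hk'
    rw [Finset.mem_Icc] at hk'
    exact gp_twist_cost_le hL hk'.2
  have h3 : ∀ k ∈ Finset.Icc 1 m, sinabs k ≤ 2 * Real.pi * (m : ℝ) * (L : ℝ) ^ 2 := by
    intro k hk'
    rw [Finset.mem_Icc] at hk'
    have hkm : (k : ℝ) ≤ m := by exact_mod_cast hk'.2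
    refine (gr_sum_abs_sin_twist_le hL k).trans ?_
    have : 0 ≤ 2 * Real.pi * (L : ℝ) ^ 2 := by positivity
    nlinarith
  have hcost0 : ∀ k, 0 ≤ cost k := fun k => Finset.sum_nonneg fun b _ => by
    linarith [Real.cos_le_one (2 * Real.pi * k * (((b.1 + Pi.single b.2 1 : TorusSite 3 L) 0).val : ℝ) / L -
      2 * Real.pi * k * ((b.1 0).val : ℝ) / L)]
  -- termwise lower bound on the summands
  have hterm : ∀ k ∈ Finset.Icc 1 m,
      -(σ / (L : ℝ) ^ 3) * (72 * t * ((L : ℝ) ^ 3) ^ 2 + 2 * (L : ℝ) ^ 3 * (2 * Real.pi ^ 2 * (m : ℝ) ^ 2 * L) +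
          2 * (L : ℝ) ^ 3 * (2 * Real.pi * (m : ℝ) * (L : ℝ) ^ 2)) -
        (σ / (L : ℝ) ^ 3 / t) * ((∫ θ in cube L, V k θ * (wJ J θ).re) / Z) - J * (2 * Real.pi ^ 2 * (m : ℝ) ^ 2 * L) ≤
      -(σ / (L : ℝ) ^ 3) * (72 * t * ((L : ℝ) ^ 3) ^ 2 + (∫ θ in cube L, V k θ * (wJ J θ).re) / Z / t +
        2 * (L : ℝ) ^ 3 * cost k + 2 * (L : ℝ) ^ 3 * sinabs k) - J * cost k := by
    intro k hk'
    have hc := h2 k hk'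
    have hs := h3 k hk'
    have hσL : 0 ≤ σ / (L : ℝ) ^ 3 := by positivity
    have hL3 : 0 ≤ (L : ℝ) ^ 3 := by positivity
    have e : -(σ / (L : ℝ) ^ 3) * (72 * t * ((L : ℝ) ^ 3) ^ 2 + (∫ θ in cube L, V k θ * (wJ J θ).re) / Z / t +
        2 * (L : ℝ) ^ 3 * cost k + 2 * (L : ℝ) ^ 3 * sinabs k) - J * cost k =
        -(σ / (L : ℝ) ^ 3) * (72 * t * ((L : ℝ) ^ 3) ^ 2 + 2 * (L : ℝ) ^ 3 * cost k + 2 * (L : ℝ) ^ 3 * sinabs k) -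
          (σ / (L : ℝ) ^ 3 / t) * ((∫ θ in cube L, V k θ * (wJ J θ).re) / Z) - J * cost k := by
      field_simp
      ring
    rw [e]
    have i1 : (σ / (L : ℝ) ^ 3) * (2 * (L : ℝ) ^ 3 * cost k) ≤ (σ / (L : ℝ) ^ 3) * (2 * (L : ℝ) ^ 3 * (2 * Real.pi ^ 2 * (m : ℝ) ^ 2 * L)) :=
      mul_le_mul_of_nonneg_left (mul_le_mul_of_nonneg_left hc (by positivity)) hσL
    have i2 : (σ / (L : ℝ) ^ 3) * (2 * (L : ℝ) ^ 3 * sinabs k) ≤ (σ / (L : ℝ) ^ 3) * (2 * (L : ℝ) ^ 3 * (2 * Real.pi * (m : ℝ) * (L : ℝ) ^ 2)) :=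
      mul_le_mul_of_nonneg_left (mul_le_mul_of_nonneg_left hs (by positivity)) hσL
    have i3 : J * cost k ≤ J * (2 * Real.pi ^ 2 * (m : ℝ) ^ 2 * L) := mul_le_mul_of_nonneg_left hc hJ
    nlinarith [i1, i2, i3]
  have hsum2 := Finset.sum_le_sum hterm
  rw [Finset.sum_sub_distrib, Finset.sum_sub_distrib, Finset.sum_const, Finset.sum_const, Nat.card_Icc,
    Nat.add_sub_cancel, nsmul_eq_mul, nsmul_eq_mul, ← Finset.mul_sum] at hsum2
  have hmain : (m : ℝ) * (-(σ / (L : ℝ) ^ 3) * (72 * t * ((L : ℝ) ^ 3) ^ 2 +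
      2 * (L : ℝ) ^ 3 * (2 * Real.pi ^ 2 * (m : ℝ) ^ 2 * L) + 2 * (L : ℝ) ^ 3 * (2 * Real.pi * (m : ℝ) * (L : ℝ) ^ 2))) -
      (σ / (L : ℝ) ^ 3 / t) * ((L : ℝ) ^ 3) ^ 2 - (m : ℝ) * (J * (2 * Real.pi ^ 2 * (m : ℝ) ^ 2 * L)) ≤ (m : ℝ) * R := by
    have hcoef : 0 ≤ σ / (L : ℝ) ^ 3 / t := by positivity
    have := mul_le_mul_of_nonneg_left h1 hcoef
    linarith [hsum, hsum2, this]
  -- plug in `m = n²`, `t = 1/(6n)` and divide by `m`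
  have hfinal : -(18 * σ * (L : ℝ) ^ 3 / n) - 4 * Real.pi ^ 2 * σ * (n : ℝ) ^ 4 * L -
      4 * Real.pi * σ * (n : ℝ) ^ 2 * (L : ℝ) ^ 2 - 2 * Real.pi ^ 2 * (n : ℝ) ^ 4 * J * L =
      ((m : ℝ) * (-(σ / (L : ℝ) ^ 3) * (72 * t * ((L : ℝ) ^ 3) ^ 2 +
        2 * (L : ℝ) ^ 3 * (2 * Real.pi ^ 2 * (m : ℝ) ^ 2 * L) + 2 * (L : ℝ) ^ 3 * (2 * Real.pi * (m : ℝ) * (L : ℝ) ^ 2))) -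
        (σ / (L : ℝ) ^ 3 / t) * ((L : ℝ) ^ 3) ^ 2 - (m : ℝ) * (J * (2 * Real.pi ^ 2 * (m : ℝ) ^ 2 * L))) / m := by
    rw [htdef, hmr]
    field_simp
    ring
  rw [hfinal, div_le_iff₀ hm0]
  linarith

/-- STUB `stub_relTwistedJensenBound` (registered on stmt-HubbardSuperconductivity-10739, line `schwarz-inheritance`, lead c19, rev 20): the
**twisted side** for the energy-weighted source, `log ⟨e^{−σR/L³}⟩_J ≥ −18σL³/n − 4π²σn⁴L − 4πσn²L² − 2π²n⁴JL` for `J, σ ≥ 0`, `1 ≤ n`,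
`n² < L` (= `gr_rel_lower_neg`). [folklore] -/
theorem stub_relTwistedJensenBound : ∀ (J : ℝ), 0 ≤ J → ∀ (L : ℕ) [NeZero L], 2 ≤ L → ∀ (σ : ℝ), 0 ≤ σ → ∀ (n : ℕ), 1 ≤ n → n ^ 2 < L →
    -(18 * σ * (L : ℝ) ^ 3 / n) - 4 * Real.pi ^ 2 * σ * (n : ℝ) ^ 4 * L - 4 * Real.pi * σ * (n : ℝ) ^ 2 * (L : ℝ) ^ 2 -
        2 * Real.pi ^ 2 * (n : ℝ) ^ 4 * J * L ≤
      Real.log ((∫ θ in cube L, Real.exp (-σ * ((∑ y : TorusSite 3 L, ∑ b : Bond L,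
        (Real.cos (θ b.1 - θ y) + Real.cos (θ (b.1 + Pi.single b.2 1) - θ y)) *
          (1 - Real.cos (θ (b.1 + Pi.single b.2 1) - θ b.1))) / (L : ℝ) ^ 3)) * (wJ J θ).re) /
        ∫ θ in cube L, (wJ J θ).re) :=
  fun _J hJ _L _ hL _σ hσ _n hn hnL => gr_rel_lower_neg hL hJ hσ hn hnL

end Summit.HubbardSuperconductivity.HubbardSuperconductivity.Theorems.PerturbedXYOrder

end
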